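import Summits.KontsevichZagierPeriods.KontsevichZagierPeriods.Theorems.RootDecompZetaThreeFrontierGZLadderLeTwo
import Summits.KontsevichZagierPeriods.KontsevichZagierPeriods.Theorems.RootDecompZetaThreeFrontierWordMatchPreludeP10

/-! # `RootDecompZetaThreeFrontierThreeLayerP1` — part 1/7 of the mechanical ≤340-line split of decomp-kz lens-1 g12 `ThreeLayer_v1.lean`
(sha256 4ebbf5d0…: §18 the diagonal-straightening move Σ / un-bending τ_v and their relations, §47 the layer ⟹ words algorithm;
`…GZLadder.stub_three_layer` of «gz_ladder» v4 on stmt-KontsevichZagierPeriods-32433 is proved in part 7).  Mathematics unchanged; first part. -/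

set_option linter.dupNamespace false

noncomputable section

namespace Summit.KontsevichZagierPeriods.RootDecompZetaThreeFrontier.WordLayer

open Set MeasureTheory MvPolynomial
open Literature.NumberTheory.Transcendental
open Summit.KontsevichZagierPeriods.KontsevichZagierPeriods.Theses.RootDecompZetaThreeFrontier
open Summit.KontsevichZagierPeriods.KontsevichZagierPeriods.Theorems.RootDecompZetaThreeFrontierWordMoves (mem_simplex_three_iff)

/-! ## §18  THE NEW MOVE OF DIMENSION 3, CERTIFIED (gen 9 addendum 4, `RUNG3.md` §3 B3): the DIAGONAL-STRAIGHTENING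
chart `Σ : (t₀,t₁,t₂) ↦ ((t₀-t₂)/(1-t₂), (t₁-t₂)/(1-t₂), t₂)` as ONE rule-(2) relation of `KZCalculus`.
We apply `changeOfVariablesRel` with the POLYNOMIAL inverse `Σ⁻¹ = stΨ : (u,v,s) ↦ (s + u(1-s), s + v(1-s), s)` from the
straightened cell `stDom = Δ₂(u,v) × (0,1)` onto `Δ₃`; `|det D stΨ| = (1-s)²`.  The diagonal factor `t₀ - t₂` becomes the
coordinate factor `u (1-s)`: this is the move that unblocks the Newton–Leibniz-stuck family `t₀^m/(t₁(t₀-t₂))` (RUNG3.md §3). -/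

section Straighten

open Literature.ModelTheory.ExponentialFields

/-- The straightened cell `{(u,v,s) | 1 > u > v > 0, 0 < s < 1}`. -/
def stDom : Set (Fin 3 → ℝ) := {p | p 1 < p 0 ∧ p 0 < 1 ∧ 0 < p 1 ∧ 0 < p 2 ∧ p 2 < 1}

/-- Auxiliary step `mem_stDom_iff` (§18): mem st Dom iff. [bookkeeping] -/
theorem mem_stDom_iff (p : Fin 3 → ℝ) :
    p ∈ stDom ↔ p 1 < p 0 ∧ p 0 < 1 ∧ 0 < p 1 ∧ 0 < p 2 ∧ p 2 < 1 := Iff.rfl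

/-- semialgebraicity of a strict polynomial inequality (tree lemma, specialised) -/
theorem isSemialgebraic_pos3 (q : MvPolynomial (Fin 3) ℚ) :
    IsSemialgebraic ℚ {p : Fin 3 → ℝ | 0 < MvPolynomial.aeval p q} :=
  Literature.ModelTheory.ExponentialFields.isSemialgebraic_setOf_eval_pos (k := ℚ) q

/-- Auxiliary step `isSemialgebraic_stDom` (§18): is Semialgebraic st Dom. [bookkeeping] -/
theorem isSemialgebraic_stDom : IsSemialgebraic ℚ stDom := by
  have e : stDom =
      (((({p : Fin 3 → ℝ | 0 < MvPolynomial.aeval p (X 0 - X 1 : MvPolynomial (Fin 3) ℚ)} ∩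
        {p | 0 < MvPolynomial.aeval p (C 1 - X 0 : MvPolynomial (Fin 3) ℚ)}) ∩
        {p | 0 < MvPolynomial.aeval p (X 1 : MvPolynomial (Fin 3) ℚ)}) ∩
        {p | 0 < MvPolynomial.aeval p (X 2 : MvPolynomial (Fin 3) ℚ)}) ∩
        {p | 0 < MvPolynomial.aeval p (C 1 - X 2 : MvPolynomial (Fin 3) ℚ)}) := by
    ext p
    simp only [mem_stDom_iff, Set.mem_inter_iff, Set.mem_setOf_eq, map_sub, MvPolynomial.aeval_X,
      map_one, sub_pos]
    tauto
  rw [e]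
  exact ((((isSemialgebraic_pos3 _).inter (isSemialgebraic_pos3 _)).inter (isSemialgebraic_pos3 _)).inter
    (isSemialgebraic_pos3 _)).inter (isSemialgebraic_pos3 _)

/-- `Σ⁻¹`, the polynomial inverse of the straightening chart: `(u,v,s) ↦ (s + u(1-s), s + v(1-s), s)`. -/
def stΨ (p : Fin 3 → ℝ) : Fin 3 → ℝ := ![p 2 + p 0 * (1 - p 2), p 2 + p 1 * (1 - p 2), p 2]

/-- Auxiliary step `stΨ_zero` (§18): stΨ zero. [bookkeeping] -/
theorem stΨ_zero (p : Fin 3 → ℝ) : stΨ p 0 = p 2 + p 0 * (1 - p 2) := by simp [stΨ]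
/-- Auxiliary step `stΨ_one` (§18): stΨ one. [bookkeeping] -/
theorem stΨ_one (p : Fin 3 → ℝ) : stΨ p 1 = p 2 + p 1 * (1 - p 2) := by simp [stΨ]
/-- Auxiliary step `stΨ_two` (§18): stΨ two. [bookkeeping] -/
theorem stΨ_two (p : Fin 3 → ℝ) : stΨ p 2 = p 2 := by simp [stΨ]

/-- the coordinate projections as continuous linear maps -/
abbrev Pj (i : Fin 3) : (Fin 3 → ℝ) →L[ℝ] ℝ :=
  ContinuousLinearMap.proj (R := ℝ) (φ := fun _ : Fin 3 => ℝ) i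

/-- the three rows of the derivative of `stΨ` at `p` -/
def stRow (p : Fin 3 → ℝ) : Fin 3 → ((Fin 3 → ℝ) →L[ℝ] ℝ) :=
  ![Pj 2 + (p 0 • (-Pj 2) + (1 - p 2) • Pj 0), Pj 2 + (p 1 • (-Pj 2) + (1 - p 2) • Pj 1), Pj 2]

/-- The derivative `D stΨ (p)`. -/
def stL (p : Fin 3 → ℝ) : (Fin 3 → ℝ) →L[ℝ] (Fin 3 → ℝ) :=
  ContinuousLinearMap.pi (stRow p)

/-- Auxiliary step `stL_apply_zero` (§18): st L apply zero. [bookkeeping] -/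
theorem stL_apply_zero (p h : Fin 3 → ℝ) : stL p h 0 = h 2 + (p 0 * (-h 2) + (1 - p 2) * h 0) := by
  simp [stL, stRow]
/-- Auxiliary step `stL_apply_one` (§18): st L apply one. [bookkeeping] -/
theorem stL_apply_one (p h : Fin 3 → ℝ) : stL p h 1 = h 2 + (p 1 * (-h 2) + (1 - p 2) * h 1) := by
  simp [stL, stRow]
/-- Auxiliary step `stL_apply_two` (§18): st L apply two. [bookkeeping] -/
theorem stL_apply_two (p h : Fin 3 → ℝ) : stL p h 2 = h 2 := by
  simp [stL, stRow]

/-- Auxiliary step `hasFDerivAt_stΨ` (§18): has FDeriv At stΨ. [bookkeeping] -/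
theorem hasFDerivAt_stΨ (p : Fin 3 → ℝ) : HasFDerivAt stΨ (stL p) p := by
  have h0 : HasFDerivAt (fun q : Fin 3 → ℝ => q 0) (Pj 0) p := hasFDerivAt_apply (𝕜 := ℝ) 0 p
  have h1 : HasFDerivAt (fun q : Fin 3 → ℝ => q 1) (Pj 1) p := hasFDerivAt_apply (𝕜 := ℝ) 1 p
  have h2 : HasFDerivAt (fun q : Fin 3 → ℝ => q 2) (Pj 2) p := hasFDerivAt_apply (𝕜 := ℝ) 2 p
  have c0 : HasFDerivAt (fun q : Fin 3 → ℝ => q 2 + q 0 * (1 - q 2))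
      (Pj 2 + (p 0 • (-Pj 2) + (1 - p 2) • Pj 0)) p := h2.add (h0.mul (h2.const_sub 1))
  have c1 : HasFDerivAt (fun q : Fin 3 → ℝ => q 2 + q 1 * (1 - q 2))
      (Pj 2 + (p 1 • (-Pj 2) + (1 - p 2) • Pj 1)) p := h2.add (h1.mul (h2.const_sub 1))
  have key : HasFDerivAt (fun q : Fin 3 → ℝ => fun i => (![q 2 + q 0 * (1 - q 2), q 2 + q 1 * (1 - q 2), q 2] :
      Fin 3 → ℝ) i) (ContinuousLinearMap.pi (stRow p)) p := by
    refine hasFDerivAt_pi.2 fun i => ?_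
    fin_cases i
    · simpa [stRow] using c0
    · simpa [stRow] using c1
    · simpa [stRow] using h2
  exact key

/-- the Jacobian matrix of `stΨ` -/
def stM (p : Fin 3 → ℝ) : Matrix (Fin 3) (Fin 3) ℝ := !![1 - p 2, 0, 1 - p 0; 0, 1 - p 2, 1 - p 1; 0, 0, 1]

/-- Auxiliary step `stL_eq_toLin'` (§18): st L eq to Lin'. [bookkeeping] -/
theorem stL_eq_toLin' (p : Fin 3 → ℝ) :
    (stL p : (Fin 3 → ℝ) →ₗ[ℝ] (Fin 3 → ℝ)) = Matrix.toLin' (stM p) := by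
  apply LinearMap.ext
  intro h
  rw [Matrix.toLin'_apply, ContinuousLinearMap.coe_coe]
  funext i
  fin_cases i
  · simp [stL_apply_zero, stM, Matrix.mulVec, dotProduct, Fin.sum_univ_three]; ring
  · simp [stL_apply_one, stM, Matrix.mulVec, dotProduct, Fin.sum_univ_three]; ring
  · simp [stL_apply_two, stM, Matrix.mulVec, dotProduct, Fin.sum_univ_three]

/-- Auxiliary step `det_stL` (§18): det st L. [bookkeeping] -/
theorem det_stL (p : Fin 3 → ℝ) : (stL p).det = (1 - p 2) ^ 2 := by
  show LinearMap.det (stL p : (Fin 3 → ℝ) →ₗ[ℝ] (Fin 3 → ℝ)) = _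
  rw [stL_eq_toLin', LinearMap.det_toLin', stM, Matrix.det_fin_three]
  simp
  ring

/-- Auxiliary step `abs_det_stL` (§18): abs det st L. [bookkeeping] -/
theorem abs_det_stL (p : Fin 3 → ℝ) : |(stL p).det| = (1 - p 2) ^ 2 := by
  rw [det_stL, abs_of_nonneg (sq_nonneg _)]

/-- Auxiliary step `stΨ_mem_simplex` (§18): stΨ mem simplex. [bookkeeping] -/
theorem stΨ_mem_simplex {p : Fin 3 → ℝ} (hp : p ∈ stDom) : stΨ p ∈ KZ.openOrderedSimplex 3 := by
  obtain ⟨h10, h0, h1, h2, h21⟩ := hp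
  rw [mem_simplex_three_iff, stΨ_zero, stΨ_one, stΨ_two]
  have hs : 0 < 1 - p 2 := by linarith
  refine ⟨h2, ?_, ?_, ?_⟩
  · nlinarith [mul_pos h1 hs]
  · nlinarith [mul_pos (sub_pos.2 h10) hs]
  · nlinarith [mul_pos (sub_pos.2 h0) hs]

/-- `Σ` itself (rational), used only to prove surjectivity of `stΨ` onto `Δ₃`. -/
noncomputable def stSig (t : Fin 3 → ℝ) : Fin 3 → ℝ := ![(t 0 - t 2) / (1 - t 2), (t 1 - t 2) / (1 - t 2), t 2]

/-- Auxiliary step `stSig_mem` (§18): st Sig mem. [bookkeeping] -/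
theorem stSig_mem {t : Fin 3 → ℝ} (ht : t ∈ KZ.openOrderedSimplex 3) : stSig t ∈ stDom := by
  obtain ⟨h2, h21, h10, h0⟩ := (mem_simplex_three_iff t).1 ht
  have hs : 0 < 1 - t 2 := by linarith
  simp only [mem_stDom_iff, stSig, Matrix.cons_val_zero, Matrix.cons_val_one, Matrix.head_cons,
    Matrix.cons_val_two, Matrix.tail_cons]
  refine ⟨?_, ?_, ?_, h2, by linarith⟩
  · exact div_lt_div_of_pos_right (by linarith) hs
  · rw [div_lt_one hs]; linarith
  · exact div_pos (by linarith) hs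

/-- Auxiliary step `stΨ_stSig` (§18): stΨ st Sig. [bookkeeping] -/
theorem stΨ_stSig {t : Fin 3 → ℝ} (ht : t ∈ KZ.openOrderedSimplex 3) : stΨ (stSig t) = t := by
  obtain ⟨h2, h21, h10, h0⟩ := (mem_simplex_three_iff t).1 ht
  have hs : (1 : ℝ) - t 2 ≠ 0 := by linarith
  funext i
  fin_cases i
  · simp [stΨ, stSig]; field_simp; ring
  · simp [stΨ, stSig]; field_simp; ring
  · simp [stΨ, stSig]

/-- Auxiliary step `image_stΨ` (§18): image stΨ. [bookkeeping] -/
theorem image_stΨ : stΨ '' stDom = KZ.openOrderedSimplex 3 := by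
  ext t
  constructor
  · rintro ⟨p, hp, rfl⟩
    exact stΨ_mem_simplex hp
  · intro ht
    exact ⟨stSig t, stSig_mem ht, stΨ_stSig ht⟩

/-- Auxiliary step `injOn_stΨ` (§18): inj On stΨ. [bookkeeping] -/
theorem injOn_stΨ : InjOn stΨ stDom := by
  intro p hp q hq h
  have e2 : p 2 = q 2 := by simpa [stΨ_two] using congrFun h 2
  have hs : (1 : ℝ) - p 2 ≠ 0 := by have := hp.2.2.2.2; linarith
  have e0 : p 0 = q 0 := by
    have := congrFun h 0
    rw [stΨ_zero, stΨ_zero, ← e2] at this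
    exact mul_right_cancel₀ hs (by linarith)
  have e1 : p 1 = q 1 := by
    have := congrFun h 1
    rw [stΨ_one, stΨ_one, ← e2] at this
    exact mul_right_cancel₀ hs (by linarith)
  funext i
  fin_cases i
  · exact e0
  · exact e1
  · exact e2

/-- Auxiliary step `isSemialgebraicMapOn_stΨ` (§18): is Semialgebraic Map On stΨ. [bookkeeping] -/
theorem isSemialgebraicMapOn_stΨ : IsSemialgebraicMapOn ℚ stDom stΨ :=
  (isSemialgebraicMapOn_aeval isSemialgebraic_stDom
    ![X 2 + X 0 * (C 1 - X 2), X 2 + X 1 * (C 1 - X 2), (X 2 : MvPolynomial (Fin 3) ℚ)]).congr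
    fun p _ => by
      funext j
      fin_cases j <;> simp [stΨ_zero, stΨ_one, stΨ_two]

/-- **THE STRAIGHTENING MOVE, PROVED** (rule (2) of `KZCalculus` with the polynomial chart `stΨ = Σ⁻¹`):
a representation `g'` on the straightened cell `stDom = Δ₂ × (0,1)` whose integrand is the pull-back
`g.integrand ∘ Σ⁻¹ · (1-s)²` is congruent to `g` on `Δ₃` modulo `KZ.relations`.  After it, the deep diagonal
factor `t₀ - t₂` of a reduced genus-zero datum is the coordinate factor `u(1-s)` (`RUNG3.md` §3 B3). -/
theorem straighten_rel (g g' : KZ.IntegralRep 3) (hg : g.domain = KZ.openOrderedSimplex 3)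
    (hg' : g'.domain = stDom)
    (hi : ∀ p ∈ stDom, g'.integrand p = g.integrand (stΨ p) * (1 - p 2) ^ 2) :
    KZ.of g' - KZ.of g ∈ KZ.relations := by
  have hΦsa : IsSemialgebraicMapOn ℚ g'.domain stΨ := by rw [hg']; exact isSemialgebraicMapOn_stΨ
  have hder : ∀ x ∈ g'.domain, HasFDerivWithinAt stΨ (stL x) g'.domain x :=
    fun x _ => (hasFDerivAt_stΨ x).hasFDerivWithinAt
  have hinj : InjOn stΨ g'.domain := by rw [hg']; exact injOn_stΨ
  have hdom : g.domain = stΨ '' g'.domain := by rw [hg', image_stΨ, hg]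
  refine KZ.changeOfVariablesRel_subset_relations ⟨3, g', g, stΨ, stL, hΦsa, hder, hinj, hdom,
    fun p hp => ?_, rfl⟩
  show g'.integrand p = g.integrand (stΨ p) * |(stL p).det|
  rw [abs_det_stL]
  exact hi p (by rw [← hg']; exact hp)

/-- The coordinate dictionary after straightening (for the move table of `RUNG3.md` §3):
`t₀ - t₂ = u(1-s)`, `t₁ = v + s(1-v)`, `1 - t₁ = (1-v)(1-s)`, `1 - t₀ = (1-u)(1-s)`, `t₀ - t₁ = (u-v)(1-s)`. -/
theorem stΨ_dictionary (p : Fin 3 → ℝ) :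
    stΨ p 0 - stΨ p 2 = p 0 * (1 - p 2) ∧ stΨ p 1 = p 1 + p 2 * (1 - p 1) ∧
    1 - stΨ p 1 = (1 - p 1) * (1 - p 2) ∧ 1 - stΨ p 0 = (1 - p 0) * (1 - p 2) ∧
    stΨ p 0 - stΨ p 1 = (p 0 - p 1) * (1 - p 2) := by
  rw [stΨ_zero, stΨ_one, stΨ_two]
  exact ⟨by ring, by ring, by ring, by ring, by ring⟩

/-- Worked instance of the dictionary: the pull-back of the NL-stuck class `G₀ = 1/(t₁(t₀-t₂))` is
`(1-s)/(u (v + s(1-v)))` — the diagonal pole has become the coordinate pole `1/u` (`RUNG3.md` §3, first bullet). -/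
theorem straighten_G0 (p : Fin 3 → ℝ) (hp : p ∈ stDom) :
    1 / (stΨ p 1 * (stΨ p 0 - stΨ p 2)) * (1 - p 2) ^ 2 = (1 - p 2) / (p 0 * (p 1 + p 2 * (1 - p 1))) := by
  obtain ⟨h10, h0, h1, h2, h21⟩ := hp
  obtain ⟨d0, d1, -, -, -⟩ := stΨ_dictionary p
  rw [d0, d1]
  have hs : (1 : ℝ) - p 2 ≠ 0 := by linarith
  have hu : p 0 ≠ 0 := by linarith
  have hw : p 1 + p 2 * (1 - p 1) ≠ 0 := by nlinarith [mul_pos h2 (show (0:ℝ) < 1 - p 1 by linarith)]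
  field_simp

/-! ### 18b  The affine un-bending chart `τ_v : (u,v,s) ↦ (u, v, v + s(1-v))` (rule (2), polynomial, `|det| = 1-v`)
from `stDom` onto the cell `stCell = {1 > u > v > 0, v < w < 1}`; after it EVERY factor of a straightened reduced
genus-zero datum is a coordinate or `1 -` a coordinate, and rule (1a) along `u = w` lands in two simplices. -/

/-- The un-bent cell `{(u,v,w) | 1 > u > v > 0, v < w < 1}`. -/
def stCell : Set (Fin 3 → ℝ) := {p | p 1 < p 0 ∧ p 0 < 1 ∧ 0 < p 1 ∧ p 1 < p 2 ∧ p 2 < 1}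

/-- Auxiliary step `mem_stCell_iff` (§18): mem st Cell iff. [bookkeeping] -/
theorem mem_stCell_iff (p : Fin 3 → ℝ) :
    p ∈ stCell ↔ p 1 < p 0 ∧ p 0 < 1 ∧ 0 < p 1 ∧ p 1 < p 2 ∧ p 2 < 1 := Iff.rfl

/-- `τ_v`. -/
def bendΦ (p : Fin 3 → ℝ) : Fin 3 → ℝ := ![p 0, p 1, p 1 + p 2 * (1 - p 1)]

/-- Auxiliary step `bendΦ_zero` (§18): bendΦ zero. [bookkeeping] -/
theorem bendΦ_zero (p : Fin 3 → ℝ) : bendΦ p 0 = p 0 := by simp [bendΦ]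
/-- Auxiliary step `bendΦ_one` (§18): bendΦ one. [bookkeeping] -/
theorem bendΦ_one (p : Fin 3 → ℝ) : bendΦ p 1 = p 1 := by simp [bendΦ]
/-- Auxiliary step `bendΦ_two` (§18): bendΦ two. [bookkeeping] -/
theorem bendΦ_two (p : Fin 3 → ℝ) : bendΦ p 2 = p 1 + p 2 * (1 - p 1) := by simp [bendΦ]

/-- rows of `D τ_v (p)` -/
def bendRow (p : Fin 3 → ℝ) : Fin 3 → ((Fin 3 → ℝ) →L[ℝ] ℝ) :=
  ![Pj 0, Pj 1, Pj 1 + (p 2 • (-Pj 1) + (1 - p 1) • Pj 2)]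

/-- `D τ_v (p)`. -/
def bendL (p : Fin 3 → ℝ) : (Fin 3 → ℝ) →L[ℝ] (Fin 3 → ℝ) :=
  ContinuousLinearMap.pi (bendRow p)

/-- Auxiliary step `bendL_apply_zero` (§18): bend L apply zero. [bookkeeping] -/
theorem bendL_apply_zero (p h : Fin 3 → ℝ) : bendL p h 0 = h 0 := by simp [bendL, bendRow]
/-- Auxiliary step `bendL_apply_one` (§18): bend L apply one. [bookkeeping] -/
theorem bendL_apply_one (p h : Fin 3 → ℝ) : bendL p h 1 = h 1 := by simp [bendL, bendRow]
/-- Auxiliary step `bendL_apply_two` (§18): bend L apply two. [bookkeeping] -/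
theorem bendL_apply_two (p h : Fin 3 → ℝ) :
    bendL p h 2 = h 1 + (p 2 * (-h 1) + (1 - p 1) * h 2) := by simp [bendL, bendRow]

/-- Auxiliary step `hasFDerivAt_bendΦ` (§18): has FDeriv At bendΦ. [bookkeeping] -/
theorem hasFDerivAt_bendΦ (p : Fin 3 → ℝ) : HasFDerivAt bendΦ (bendL p) p := by
  have h0 : HasFDerivAt (fun q : Fin 3 → ℝ => q 0) (Pj 0) p := hasFDerivAt_apply (𝕜 := ℝ) 0 p
  have h1 : HasFDerivAt (fun q : Fin 3 → ℝ => q 1) (Pj 1) p := hasFDerivAt_apply (𝕜 := ℝ) 1 p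
  have h2 : HasFDerivAt (fun q : Fin 3 → ℝ => q 2) (Pj 2) p := hasFDerivAt_apply (𝕜 := ℝ) 2 p
  have c2 : HasFDerivAt (fun q : Fin 3 → ℝ => q 1 + q 2 * (1 - q 1))
      (Pj 1 + (p 2 • (-Pj 1) + (1 - p 1) • Pj 2)) p := h1.add (h2.mul (h1.const_sub 1))
  have key : HasFDerivAt (fun q : Fin 3 → ℝ => fun i => (![q 0, q 1, q 1 + q 2 * (1 - q 1)] :
      Fin 3 → ℝ) i) (ContinuousLinearMap.pi (bendRow p)) p := by
    refine hasFDerivAt_pi.2 fun i => ?_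
    fin_cases i
    · simpa [bendRow] using h0
    · simpa [bendRow] using h1
    · simpa [bendRow] using c2
  exact key

/-- Jacobian matrix of `τ_v` -/
def bendM (p : Fin 3 → ℝ) : Matrix (Fin 3) (Fin 3) ℝ := !![1, 0, 0; 0, 1, 0; 0, 1 - p 2, 1 - p 1]

/-- Auxiliary step `bendL_eq_toLin'` (§18): bend L eq to Lin'. [bookkeeping] -/
theorem bendL_eq_toLin' (p : Fin 3 → ℝ) :
    (bendL p : (Fin 3 → ℝ) →ₗ[ℝ] (Fin 3 → ℝ)) = Matrix.toLin' (bendM p) := by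
  apply LinearMap.ext
  intro h
  rw [Matrix.toLin'_apply, ContinuousLinearMap.coe_coe]
  funext i
  fin_cases i
  · simp [bendL_apply_zero, bendM, Matrix.mulVec, dotProduct, Fin.sum_univ_three]
  · simp [bendL_apply_one, bendM, Matrix.mulVec, dotProduct, Fin.sum_univ_three]
  · simp [bendL_apply_two, bendM, Matrix.mulVec, dotProduct, Fin.sum_univ_three]; ring

/-- Auxiliary step `det_bendL` (§18): det bend L. [bookkeeping] -/
theorem det_bendL (p : Fin 3 → ℝ) : (bendL p).det = 1 - p 1 := by
  show LinearMap.det (bendL p : (Fin 3 → ℝ) →ₗ[ℝ] (Fin 3 → ℝ)) = _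
  rw [bendL_eq_toLin', LinearMap.det_toLin', bendM, Matrix.det_fin_three]
  simp

/-- Auxiliary step `bendΦ_mem_cell` (§18): bendΦ mem cell. [bookkeeping] -/
theorem bendΦ_mem_cell {p : Fin 3 → ℝ} (hp : p ∈ stDom) : bendΦ p ∈ stCell := by
  obtain ⟨h10, h0, h1, h2, h21⟩ := hp
  rw [mem_stCell_iff, bendΦ_zero, bendΦ_one, bendΦ_two]
  have hv : 0 < 1 - p 1 := by linarith
  refine ⟨h10, h0, h1, ?_, ?_⟩
  · nlinarith [mul_pos h2 hv]
  · nlinarith [mul_pos (sub_pos.2 h21) hv]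

/-- the inverse of `τ_v` (rational), used only for surjectivity -/
noncomputable def bendInv (t : Fin 3 → ℝ) : Fin 3 → ℝ := ![t 0, t 1, (t 2 - t 1) / (1 - t 1)]

/-- Auxiliary step `bendInv_mem` (§18): bend Inv mem. [bookkeeping] -/
theorem bendInv_mem {t : Fin 3 → ℝ} (ht : t ∈ stCell) : bendInv t ∈ stDom := by
  obtain ⟨h10, h0, h1, h12, h2⟩ := ht
  have hv : 0 < 1 - t 1 := by linarith
  simp only [mem_stDom_iff, bendInv, Matrix.cons_val_zero, Matrix.cons_val_one, Matrix.head_cons,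
    Matrix.cons_val_two, Matrix.tail_cons]
  refine ⟨h10, h0, h1, ?_, ?_⟩
  · exact div_pos (by linarith) hv
  · rw [div_lt_one hv]; linarith

/-- Auxiliary step `bendΦ_bendInv` (§18): bendΦ bend Inv. [bookkeeping] -/
theorem bendΦ_bendInv {t : Fin 3 → ℝ} (ht : t ∈ stCell) : bendΦ (bendInv t) = t := by
  obtain ⟨h10, h0, h1, h12, h2⟩ := ht
  have hv : (1 : ℝ) - t 1 ≠ 0 := by linarith
  funext i
  fin_cases i
  · simp [bendΦ, bendInv]
  · simp [bendΦ, bendInv]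
  · simp [bendΦ, bendInv]; field_simp; ring

end Straighten

end Summit.KontsevichZagierPeriods.RootDecompZetaThreeFrontier.WordLayer
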